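import Mathlib
import HarnessLib
import Summits.NavierStokesRegularity.NavierStokesRegularity.Theorems.TypeILiouvilleStrainLedgerExtinction
import Literature.Analysis.FluidPDE.KNSSRemark61
import Literature.Analysis.FluidPDE.CurlFreeLiouville
import Literature.Analysis.FluidPDE.AncientMildCompactness

/-!
# TypeILiouvilleStrainLedgerStarved — crux (L) stmt-NavierStokesRegularity-10661 `TypeIliouvilleL`,
# registered stub `stub_quiescentLiouville` (L_Q): STARVED LIOUVILLE, THE LEDGER'S LOGARITHMIC FLOOR,
# AND THE INTEGRABLE-GRADIENT STRATUM OF L_Q IS EMPTY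

Helper for stmt-NavierStokesRegularity-10661 (`--supports`); theorems only, no definitions, no named-fact
hypotheses; closes no item; Navier–Stokes regularity is NOT proved here.  Kernel source for §1–§3: the decomp-ns
cell's lens-2 g17 node «THE STRAIN LEDGER» §6–§7 (`run/shared/lean/pub/decomp-ns/decomp-ns-lens-2/StrainLedger.lean`,
critic row 200 CLEARED, «BANK as Theorems --supports 10661»), banked DEF-FREE (`StrainStarved` / `StrainFed` /
`StarvedLiouville` unfolded into binders) by the leafhand seat of the EulerZoomLiouville route; §4 is new.

Class P = print's class of bounded ancient mild solutions (continuous and bounded on `(−∞,0) × ℝ³`, weakly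
divergence free, Oseen integral equation), as in `TypeILiouvilleStrainLedgerExtinction`.

* §1 `const_of_curl_eq_zero` — a class-P flow with identically vanishing vorticity is ONE constant vector
  (smooth slices, curl-free + div-free + bounded ⟹ constant slice, KNSS Remark 6.1 ⟹ the slice constants agree).
* §2 `const_of_strainStarved` — **STV, STARVED LIOUVILLE (the floor cell of the strain-ledger dial)**: if at every
  `t < 0` the backward ledger `Ω₀ · exp ∫_s^t Λ` (window `[s,t]`, continuous strain majorant `Λ`, vorticity bound
  `Ω₀` at `s`) can be made arbitrarily small, the flow is constant (VE of the companion file).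
* §3 `ledger_ge_of_not_const` / `log_le_ledger_of_not_const` / `ledger_tendsto_atTop_of_not_const` — **STRUCTURE LAW
  OF THE RESIDUAL**: a NON-CONSTANT class-P flow is strain-FED — some `t < 0`, `ε > 0` with `ε ≤ Ω₀ · exp ∫_s^t Λ`
  for EVERY admissible past datum; hence the logarithmic floor `∫_s^t Λ ≥ log (ε/Ω₀)` and the DIVERGENCE of the
  backward strain ledger along every sequence of past data whose vorticity bounds tend to zero.
* §4 `const_of_integrable_gradient_tail` (NEW) — **THE INTEGRABLE-GRADIENT STRATUM IS EMPTY**: a class-P flow with a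
  continuous gradient majorant `‖∇v(τ,x)‖ ≤ g τ` (`τ < 0`) that is INTEGRABLE on some past half-line `(−∞, t₀]` is
  constant.  With `TypeILiouvilleQuiescentGradient.quiescent_iff_fderiv_small` (quiescent ⟺ `sup_x‖∇v(t,·)‖ → 0`)
  this reads on the registered residual L_Q: a non-constant QUIESCENT member must have a NON-INTEGRABLE gradient tail
  (harmonic or slower): faster-than-harmonic gradient decay is excluded in the kernel (§5 makes the rate sharp).

[cite: KochNadirashviliSereginSverak2009, §4 and Remark 6.1 (arXiv:0709.3599); MajdaBertozzi2002, eq. (3.80)]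
-/

noncomputable section
open MeasureTheory Filter Set Function Metric
open scoped Topology RealInnerProductSpace ContDiff ENNReal NNReal
open Literature.Analysis Literature.Analysis.FluidPDE Literature.Analysis.UnboundedOperators
set_option linter.dupNamespace false
namespace Summit.NavierStokesRegularity.NavierStokesRegularity.Theorems.TypeILiouvilleStrainLedger

/-! ## §1 Zero vorticity ⟹ one constant -/

/-- A class-P flow with identically vanishing vorticity is ONE constant: smooth slices
(`smooth_and_bounds_of_bounded_ancient_oseenMild`), weakly ⟹ classically div-free, curl-free bounded div-free
fields on `ℝ³` are constant (`eq_of_curl_eq_zero_of_isDivFree_of_bounded`), slice constants agree (KNSS Remark 6.1,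
`KNSS2009_remark61`). [cite: KochNadirashviliSereginSverak2009, Remark 6.1 (arXiv:0709.3599)] -/
theorem const_of_curl_eq_zero
    {v : ℝ → EuclideanSpace ℝ (Fin 3) → EuclideanSpace ℝ (Fin 3)}
    (hc : ContinuousOn (uncurry v) (Iio 0 ×ˢ univ))
    (hK : ∃ K : ℝ, ∀ t < 0, ∀ x, ‖v t x‖ ≤ K)
    (hd : ∀ t < 0, IsWeaklyDivFree (v t))
    (hm : ∀ s t : ℝ, s < t → t < 0 → ∀ x,
      v t x = heatExtension (v s) (t - s) x - oseenDuhamel 1 s v v t x)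
    (hω : ∀ t < 0, ∀ x, curl (v t) x = 0) :
    ∃ b : EuclideanSpace ℝ (Fin 3), ∀ t < 0, ∀ x, v t x = b := by
  obtain ⟨K, hKb⟩ := hK
  obtain ⟨hsm, -⟩ := smooth_and_bounds_of_bounded_ancient_oseenMild hc hd hm hKb
  have hsm' : IsSmoothSpaceTimeOn (Iio 0) v := hsm
  have hslice : ∀ t < 0, ContDiff ℝ 2 (v t) := fun t ht =>
    (hsm'.contDiff_slice (mem_Iio.2 ht)).of_le (by norm_cast)
  have hdiv' : ∀ t < 0, VectorCalculus.IsDivFree (v t) := fun t ht =>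
    (hd t ht).isDivFree_of_contDiff ((hslice t ht).of_le (by norm_num))
  have hub : ∀ t < 0, ∀ x, v t x = v t 0 := fun t ht x =>
    eq_of_curl_eq_zero_of_isDivFree_of_bounded (hslice t ht) (hω t ht) (hdiv' t ht)
      (fun z => hKb t ht z) x 0
  have hmild1 : ∀ s t : ℝ, s < t → t < 0 → ∀ᵐ x ∂(volume : Measure (EuclideanSpace ℝ (Fin 3))),
      v t x = heatExtension (v s) (1 * (t - s)) x - oseenDuhamel 1 s v v t x :=
    fun s t hst ht => Eventually.of_forall fun x => by rw [one_mul]; exact hm s t hst ht x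
  have htime := KNSS2009_remark61 one_pos (b := fun t => v t 0) hub hmild1
  exact ⟨v (-1) 0, fun t ht x => by rw [hub t ht x]; exact htime t (-1) ht (by norm_num)⟩

/-! ## §2 STV — starved flows are constant -/

/-- **STV — STARVED LIOUVILLE.**  A class-P flow which is STRAIN-STARVED — at every `t < 0` and for every `ε > 0`
there is a window `[s,t]`, a continuous strain majorant `Λ` on it (`⟪∇v(τ,x)ξ,ξ⟫ ≤ Λ τ ‖ξ‖²`) and a vorticity bound
`‖curl v(s,·)‖ ≤ Ω₀` with ledger `Ω₀ · exp ∫_s^t Λ < ε` — is one constant vector.  (VE forces `curl v ≡ 0`, then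
§1.)  The floor cell of the strain-ledger dial on L_Q is thereby DECIDED; what remains of L_Q is the strain-FED cell
(§3). [cite: MajdaBertozzi2002, eq. (3.80); KochNadirashviliSereginSverak2009, Remark 6.1] -/
theorem const_of_strainStarved
    {v : ℝ → EuclideanSpace ℝ (Fin 3) → EuclideanSpace ℝ (Fin 3)}
    (hc : ContinuousOn (uncurry v) (Iio 0 ×ˢ univ))
    (hK : ∃ K : ℝ, ∀ t < 0, ∀ x, ‖v t x‖ ≤ K)
    (hd : ∀ t < 0, IsWeaklyDivFree (v t))
    (hm : ∀ s t : ℝ, s < t → t < 0 → ∀ x,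
      v t x = heatExtension (v s) (t - s) x - oseenDuhamel 1 s v v t x)
    (hstarved : ∀ t < 0, ∀ ε : ℝ, 0 < ε → ∃ s : ℝ, s < t ∧ ∃ Λ : ℝ → ℝ, Continuous Λ ∧
      (∀ τ ∈ Icc s t, ∀ x ξ : EuclideanSpace ℝ (Fin 3), ⟪fderiv ℝ (v τ) x ξ, ξ⟫ ≤ Λ τ * ‖ξ‖ ^ 2) ∧
      ∃ Ω₀ : ℝ, (∀ x, ‖curl (v s) x‖ ≤ Ω₀) ∧ Ω₀ * Real.exp (∫ τ in s..t, Λ τ) < ε) :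
    ∃ b : EuclideanSpace ℝ (Fin 3), ∀ t < 0, ∀ x, v t x = b := by
  refine const_of_curl_eq_zero hc hK hd hm fun t ht x => ?_
  by_contra hne
  have hpos : 0 < ‖curl (v t) x‖ := norm_pos_iff.2 hne
  obtain ⟨s, hst, Λ, hΛc, hΛ, Ω₀, hΩ, hlt⟩ := hstarved t ht _ hpos
  have hle := norm_curl_le_mul_exp_integral_strain hc hK hd hm hst ht hΛc hΛ hΩ x
  linarith

/-! ## §3 Structure law of the residual: non-constant ⟹ fed, logarithmic floor, divergent ledger -/

/-- **A NON-CONSTANT CLASS-P FLOW IS STRAIN-FED**: there are `t < 0` and `ε > 0` such that EVERY admissible past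
datum — window `[s,t]`, continuous strain majorant `Λ` on it, vorticity bound `Ω₀` at `s` — has ledger
`Ω₀ · exp ∫_s^t Λ ≥ ε` (the literal negation of starvation, by §2). [cite: MajdaBertozzi2002, eq. (3.80)] -/
theorem ledger_ge_of_not_const
    {v : ℝ → EuclideanSpace ℝ (Fin 3) → EuclideanSpace ℝ (Fin 3)}
    (hc : ContinuousOn (uncurry v) (Iio 0 ×ˢ univ))
    (hK : ∃ K : ℝ, ∀ t < 0, ∀ x, ‖v t x‖ ≤ K)
    (hd : ∀ t < 0, IsWeaklyDivFree (v t))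
    (hm : ∀ s t : ℝ, s < t → t < 0 → ∀ x,
      v t x = heatExtension (v s) (t - s) x - oseenDuhamel 1 s v v t x)
    (hne : ¬ ∃ b : EuclideanSpace ℝ (Fin 3), ∀ t < 0, ∀ x, v t x = b) :
    ∃ t : ℝ, t < 0 ∧ ∃ ε : ℝ, 0 < ε ∧ ∀ s : ℝ, s < t → ∀ Λ : ℝ → ℝ, Continuous Λ →
      (∀ τ ∈ Icc s t, ∀ x ξ : EuclideanSpace ℝ (Fin 3), ⟪fderiv ℝ (v τ) x ξ, ξ⟫ ≤ Λ τ * ‖ξ‖ ^ 2) →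
      ∀ Ω₀ : ℝ, (∀ x, ‖curl (v s) x‖ ≤ Ω₀) → ε ≤ Ω₀ * Real.exp (∫ τ in s..t, Λ τ) := by
  by_contra hfed
  push Not at hfed
  refine hne (const_of_strainStarved hc hK hd hm fun t ht ε hε => ?_)
  obtain ⟨s, hst, Λ, hΛc, hΛ, Ω₀, hΩ, hlt⟩ := hfed t ht ε hε
  exact ⟨s, hst, Λ, hΛc, hΛ, Ω₀, hΩ, hlt⟩

/-- `ε ≤ Ω₀ e^{I}` with `ε, Ω₀ > 0` ⟹ `log (ε/Ω₀) ≤ I`. [folklore] -/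
theorem log_div_le_of_le_mul_exp {ε Ω₀ I : ℝ} (hε : 0 < ε) (hΩ : 0 < Ω₀)
    (h : ε ≤ Ω₀ * Real.exp I) : Real.log (ε / Ω₀) ≤ I := by
  have h1 : ε / Ω₀ ≤ Real.exp I := by rw [div_le_iff₀ hΩ]; linarith [mul_comm Ω₀ (Real.exp I)]
  exact (Real.log_le_log (div_pos hε hΩ) h1).trans_eq (Real.log_exp I)

/-- Abstract divergence: floors `ε ≤ Ωₖ e^{Iₖ}` with `Ωₖ → 0⁺` force `Iₖ → +∞`. [folklore] -/
theorem tendsto_atTop_of_le_mul_exp {ε : ℝ} (hε : 0 < ε) {Ω I : ℕ → ℝ} (hΩpos : ∀ k, 0 < Ω k)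
    (hΩ : Tendsto Ω atTop (𝓝 0)) (h : ∀ k, ε ≤ Ω k * Real.exp (I k)) :
    Tendsto I atTop atTop := by
  have hΩ' : Tendsto Ω atTop (𝓝[>] 0) :=
    tendsto_nhdsWithin_iff.2 ⟨hΩ, Eventually.of_forall fun k => hΩpos k⟩
  have h1 : Tendsto (fun k => ε * (Ω k)⁻¹) atTop atTop :=
    (tendsto_inv_nhdsGT_zero.comp hΩ').const_mul_atTop hε
  have h2 : Tendsto (fun k => Real.log (ε / Ω k)) atTop atTop := by
    have h := Real.tendsto_log_atTop.comp h1
    simpa [Function.comp_def, div_eq_mul_inv] using h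
  exact tendsto_atTop_mono (fun k => log_div_le_of_le_mul_exp hε (hΩpos k) (h k)) h2

/-- **LOGARITHMIC FLOOR**: for a non-constant class-P flow there are `t < 0`, `ε > 0` such that every admissible past
datum `(s, Λ, Ω₀ > 0)` has `∫_s^t Λ ≥ log (ε/Ω₀)`. [cite: MajdaBertozzi2002, eq. (3.80)] -/
theorem log_le_ledger_of_not_const
    {v : ℝ → EuclideanSpace ℝ (Fin 3) → EuclideanSpace ℝ (Fin 3)}
    (hc : ContinuousOn (uncurry v) (Iio 0 ×ˢ univ))
    (hK : ∃ K : ℝ, ∀ t < 0, ∀ x, ‖v t x‖ ≤ K)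
    (hd : ∀ t < 0, IsWeaklyDivFree (v t))
    (hm : ∀ s t : ℝ, s < t → t < 0 → ∀ x,
      v t x = heatExtension (v s) (t - s) x - oseenDuhamel 1 s v v t x)
    (hne : ¬ ∃ b : EuclideanSpace ℝ (Fin 3), ∀ t < 0, ∀ x, v t x = b) :
    ∃ t : ℝ, t < 0 ∧ ∃ ε : ℝ, 0 < ε ∧ ∀ s : ℝ, s < t → ∀ Λ : ℝ → ℝ, Continuous Λ →
      (∀ τ ∈ Icc s t, ∀ x ξ : EuclideanSpace ℝ (Fin 3), ⟪fderiv ℝ (v τ) x ξ, ξ⟫ ≤ Λ τ * ‖ξ‖ ^ 2) →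
      ∀ Ω₀ : ℝ, 0 < Ω₀ → (∀ x, ‖curl (v s) x‖ ≤ Ω₀) → Real.log (ε / Ω₀) ≤ ∫ τ in s..t, Λ τ := by
  obtain ⟨t, ht, ε, hε, h⟩ := ledger_ge_of_not_const hc hK hd hm hne
  exact ⟨t, ht, ε, hε, fun s hs Λ hΛc hΛ Ω₀ hΩ0 hΩ =>
    log_div_le_of_le_mul_exp hε hΩ0 (h s hs Λ hΛc hΛ Ω₀ hΩ)⟩

/-- **DIVERGENT LEDGER**: for a non-constant class-P flow there is `t < 0` such that along ANY sequence of admissible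
past data `(s_k, Λ_k, Ω_k)` whose vorticity bounds `Ω_k > 0` tend to zero (vorticity-quiescent past data), the
backward strain ledgers `∫_{s_k}^t Λ_k` tend to `+∞`.  Under the Type-I door (`Λ τ ≤ σ/(−τ)`) this says the mean
stretching number is `≥ 1` on long windows. [cite: MajdaBertozzi2002, eq. (3.80)] -/
theorem ledger_tendsto_atTop_of_not_const
    {v : ℝ → EuclideanSpace ℝ (Fin 3) → EuclideanSpace ℝ (Fin 3)}
    (hc : ContinuousOn (uncurry v) (Iio 0 ×ˢ univ))
    (hK : ∃ K : ℝ, ∀ t < 0, ∀ x, ‖v t x‖ ≤ K)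
    (hd : ∀ t < 0, IsWeaklyDivFree (v t))
    (hm : ∀ s t : ℝ, s < t → t < 0 → ∀ x,
      v t x = heatExtension (v s) (t - s) x - oseenDuhamel 1 s v v t x)
    (hne : ¬ ∃ b : EuclideanSpace ℝ (Fin 3), ∀ t < 0, ∀ x, v t x = b) :
    ∃ t : ℝ, t < 0 ∧ ∀ (s : ℕ → ℝ) (Λ : ℕ → ℝ → ℝ) (Ω : ℕ → ℝ),
      (∀ k, s k < t) → (∀ k, Continuous (Λ k)) →
      (∀ k, ∀ τ ∈ Icc (s k) t, ∀ x ξ : EuclideanSpace ℝ (Fin 3), ⟪fderiv ℝ (v τ) x ξ, ξ⟫ ≤ Λ k τ * ‖ξ‖ ^ 2) →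
      (∀ k, 0 < Ω k) → (∀ k x, ‖curl (v (s k)) x‖ ≤ Ω k) → Tendsto Ω atTop (𝓝 0) →
        Tendsto (fun k => ∫ τ in (s k)..t, Λ k τ) atTop atTop := by
  obtain ⟨t, ht, ε, hε, h⟩ := ledger_ge_of_not_const hc hK hd hm hne
  exact ⟨t, ht, fun s Λ Ω hs hΛc hΛ hΩpos hΩ hΩ0 =>
    tendsto_atTop_of_le_mul_exp hε hΩpos hΩ0 fun k => h (s k) (hs k) (Λ k) (hΛc k) (hΛ k) (Ω k) (hΩ k)⟩

/-! ## §4 The integrable-gradient stratum of L_Q is empty (new) -/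

/-- A continuous `g ≥ 0` on `(−∞, b]`, integrable there, takes values `< ε` below any `a ≤ b`: otherwise
`ε · (a − s) ≤ ∫_s^a g ≤ ∫_{(−∞,b]} g` for every `s < a`. [folklore] -/
theorem exists_lt_of_integrableOn_Iic {g : ℝ → ℝ} (hgc : Continuous g) {b : ℝ}
    (hg0 : ∀ τ ≤ b, 0 ≤ g τ) (hint : IntegrableOn g (Iic b)) {a : ℝ} (hab : a ≤ b)
    {ε : ℝ} (hε : 0 < ε) : ∃ s, s < a ∧ g s < ε := by
  by_contra hcon
  push Not at hcon
  set I : ℝ := ∫ τ in Iic b, g τ with hI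
  have hI0 : 0 ≤ I := setIntegral_nonneg measurableSet_Iic fun τ hτ => hg0 τ hτ
  set s : ℝ := a - (I + 1) / ε with hs
  have hsa : s < a := by
    have : 0 < (I + 1) / ε := div_pos (by linarith) hε
    linarith
  -- `ε (a - s) ≤ ∫_s^a g`
  have hlow : ε * (a - s) ≤ ∫ τ in s..a, g τ := by
    have h1 : ∫ τ in s..a, ε = (a - s) * ε := by
      rw [intervalIntegral.integral_const, smul_eq_mul]
    have h2 : ∫ τ in s..a, ε ≤ ∫ τ in s..a, g τ :=
      intervalIntegral.integral_mono_on hsa.le intervalIntegrable_const (hgc.intervalIntegrable _ _)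
        fun τ hτ => by
          rcases eq_or_lt_of_le hτ.2 with h | h
          · -- at the right endpoint use continuity: `g a ≥ ε` as a limit of `g τ ≥ ε`, `τ < a`
            subst h
            have hclosed : IsClosed {x | ε ≤ g x} := isClosed_le continuous_const hgc
            have hmem : τ ∈ closure (Iio τ) := by rw [closure_Iio]; exact self_mem_Iic
            exact hclosed.closure_subset_iff.2 (fun x hx => hcon x hx) hmem
          · exact hcon τ h
    rw [h1] at h2
    linarith
  -- `∫_s^a g ≤ I`
  have hup : ∫ τ in s..a, g τ ≤ I := by
    rw [intervalIntegral.integral_of_le hsa.le]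
    exact setIntegral_mono_set hint (ae_restrict_of_forall_mem measurableSet_Iic fun τ hτ => hg0 τ hτ)
      (Eventually.of_forall fun τ hτ => hτ.2.trans hab)
  have hεs : ε * (a - s) = I + 1 := by
    rw [hs]; field_simp; ring
  linarith

/-- **THE INTEGRABLE-GRADIENT STRATUM OF L_Q IS EMPTY.**  A class-P flow admitting a continuous gradient majorant
`‖∇v(τ,x)‖ ≤ g τ` for all `τ < 0` which is integrable on some half-line `(−∞, t₀]` is one constant
vector.  Proof: for `t < 0` and `x`, pick `s < min t t₀ − 1` with `g s < ε` (§4 lemma); VE on `[s,t]` with the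
gradient majorant gives `‖curl v(t,x)‖ ≤ ‖curlCLM‖ · g(s) · exp ∫_s^t g ≤ ‖curlCLM‖ · ε · exp ∫_{(−∞,t]} g`; `ε → 0`
kills the vorticity, then §1.  Reading on the registered residual (with `TypeILiouvilleQuiescentGradient`): a
non-constant quiescent class-P flow has `sup_x‖∇v(τ,·)‖ → 0` with a NON-INTEGRABLE tail.
[cite: MajdaBertozzi2002, eq. (3.80); KochNadirashviliSereginSverak2009, §4] -/
theorem const_of_integrable_gradient_tail
    {v : ℝ → EuclideanSpace ℝ (Fin 3) → EuclideanSpace ℝ (Fin 3)}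
    (hc : ContinuousOn (uncurry v) (Iio 0 ×ˢ univ))
    (hK : ∃ K : ℝ, ∀ t < 0, ∀ x, ‖v t x‖ ≤ K)
    (hd : ∀ t < 0, IsWeaklyDivFree (v t))
    (hm : ∀ s t : ℝ, s < t → t < 0 → ∀ x,
      v t x = heatExtension (v s) (t - s) x - oseenDuhamel 1 s v v t x)
    {g : ℝ → ℝ} (hgc : Continuous g)
    (hg : ∀ τ < 0, ∀ x : EuclideanSpace ℝ (Fin 3), ‖fderiv ℝ (v τ) x‖ ≤ g τ)
    {t₀ : ℝ} (hint : IntegrableOn g (Iic t₀)) :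
    ∃ b : EuclideanSpace ℝ (Fin 3), ∀ t < 0, ∀ x, v t x = b := by
  have hg0 : ∀ τ < 0, 0 ≤ g τ := fun τ hτ => (norm_nonneg _).trans (hg τ hτ 0)
  -- integrability on every past half-line `(−∞, t]`, `t < 0`
  have hintt : ∀ t < 0, IntegrableOn g (Iic t) := by
    intro t ht
    rcases le_or_gt t t₀ with h | h
    · exact hint.mono_set (Iic_subset_Iic.2 h)
    · have h2 : IntegrableOn g (Icc t₀ t) := hgc.continuousOn.integrableOn_Icc
      have hun : Iic t = Iic t₀ ∪ Icc t₀ t := by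
        ext τ; simp only [mem_Iic, mem_union, mem_Icc]
        constructor
        · intro hτ; rcases le_or_gt τ t₀ with h' | h'
          · exact Or.inl h'
          · exact Or.inr ⟨h'.le, hτ⟩
        · rintro (h' | h'); exacts [h'.trans h.le, h'.2]
      rw [hun]; exact hint.union h2
  refine const_of_curl_eq_zero hc hK hd hm fun t ht x => ?_
  -- the ledger constant at `t`
  set I : ℝ := ∫ τ in Iic t, g τ with hI
  set A : ℝ := ‖curlCLM‖ * Real.exp I with hA
  have hA0 : 0 ≤ A := mul_nonneg (norm_nonneg curlCLM) (Real.exp_pos _).le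
  -- `‖curl v(t,x)‖ ≤ A ε` for every `ε > 0`
  have hsmall : ∀ ε : ℝ, 0 < ε → ‖curl (v t) x‖ ≤ A * ε := by
    intro ε hε
    obtain ⟨s, hs, hgs⟩ := exists_lt_of_integrableOn_Iic hgc (b := t) (fun τ hτ => hg0 τ (lt_of_le_of_lt hτ ht))
      (hintt t ht) (a := t - 1) (by linarith) hε
    have hst : s < t := by linarith
    have hΩ : ∀ y, ‖curl (v s) y‖ ≤ ‖curlCLM‖ * g s := fun y =>
      calc ‖curl (v s) y‖ = ‖curlCLM (fderiv ℝ (v s) y)‖ := rfl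
        _ ≤ ‖curlCLM‖ * ‖fderiv ℝ (v s) y‖ := ContinuousLinearMap.le_opNorm _ _
        _ ≤ ‖curlCLM‖ * g s := mul_le_mul_of_nonneg_left (hg s (hst.trans ht) y) (norm_nonneg curlCLM)
    have hVE := norm_curl_le_mul_exp_integral_norm_fderiv hc hK hd hm hst ht hgc
      (fun τ hτ y => hg τ (lt_of_le_of_lt hτ.2 ht) y) hΩ x
    -- `∫_s^t g ≤ I`
    have hup : ∫ τ in s..t, g τ ≤ I := by
      rw [intervalIntegral.integral_of_le hst.le]
      exact setIntegral_mono_set (hintt t ht)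
        (ae_restrict_of_forall_mem measurableSet_Iic fun τ hτ => hg0 τ (lt_of_le_of_lt hτ ht))
        (Eventually.of_forall fun τ hτ => hτ.2)
    have hexp : Real.exp (∫ τ in s..t, g τ) ≤ Real.exp I := Real.exp_le_exp.2 hup
    calc ‖curl (v t) x‖ ≤ ‖curlCLM‖ * g s * Real.exp (∫ τ in s..t, g τ) := hVE
      _ ≤ ‖curlCLM‖ * ε * Real.exp I := by
          have h1 : ‖curlCLM‖ * g s ≤ ‖curlCLM‖ * ε := mul_le_mul_of_nonneg_left hgs.le (norm_nonneg curlCLM)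
          exact mul_le_mul h1 hexp (Real.exp_pos _).le (mul_nonneg (norm_nonneg curlCLM) hε.le)
      _ = A * ε := by rw [hA]; ring
  -- hence zero
  by_contra hne
  have hpos : 0 < ‖curl (v t) x‖ := norm_pos_iff.2 hne
  have h := hsmall (‖curl (v t) x‖ / (2 * (A + 1))) (div_pos hpos (by linarith))
  have hA1 : A / (2 * (A + 1)) < 1 := by
    rw [div_lt_one (by linarith)]; linarith
  have : ‖curl (v t) x‖ ≤ (A / (2 * (A + 1))) * ‖curl (v t) x‖ := by
    calc ‖curl (v t) x‖ ≤ A * (‖curl (v t) x‖ / (2 * (A + 1))) := h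
      _ = (A / (2 * (A + 1))) * ‖curl (v t) x‖ := by ring
  nlinarith

/-! ## §5 The Type-I-rate ledger on print's class: stretching exponent below the vorticity-decay exponent (new) -/

/-- **LEDGER LIOUVILLE AT THE TYPE-I RATE ON PRINT'S CLASS.**  Let `v` be a class-P flow whose stretching form is
bounded above at the harmonic rate, `⟪∇v(τ,x) ξ, ξ⟫ ≤ (a/(−τ))‖ξ‖²` (`0 ≤ a`), and whose vorticity decays like
`‖curl v(τ,x)‖ ≤ M (−τ)^{−β}` with `a < β`.  Then `v` is one constant vector: the backward ledger of the window
`[−σ, t]` is `M σ^{−β} · (σ/(−t))^{a} = M (−t)^{−a} σ^{a−β} → 0` (`σ → ∞`), so the flow is strain-starved (§2).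
On the Type-I mild class (`‖∇u‖ ≲ 1/(−t)`, so `β = 1`) this is the strain-shape threshold `a < 1` of
`TypeILiouvilleStrainLedgerTypeIGauge.typeI_eq_zero_of_stretching_le`; here the class is print's BOUNDED class and
the decay of the vorticity is the explicit second dial. [cite: MajdaBertozzi2002, eq. (3.80)] -/
theorem const_of_stretching_lt_vorticity_decay
    {v : ℝ → EuclideanSpace ℝ (Fin 3) → EuclideanSpace ℝ (Fin 3)}
    (hc : ContinuousOn (uncurry v) (Iio 0 ×ˢ univ))
    (hK : ∃ K : ℝ, ∀ t < 0, ∀ x, ‖v t x‖ ≤ K)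
    (hd : ∀ t < 0, IsWeaklyDivFree (v t))
    (hm : ∀ s t : ℝ, s < t → t < 0 → ∀ x,
      v t x = heatExtension (v s) (t - s) x - oseenDuhamel 1 s v v t x)
    {a β M : ℝ} (haβ : a < β)
    (hstr : ∀ τ < 0, ∀ x ξ : EuclideanSpace ℝ (Fin 3), ⟪fderiv ℝ (v τ) x ξ, ξ⟫ ≤ a / (-τ) * ‖ξ‖ ^ 2)
    (hω : ∀ τ < 0, ∀ x : EuclideanSpace ℝ (Fin 3), ‖curl (v τ) x‖ ≤ M * (-τ) ^ (-β)) :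
    ∃ b : EuclideanSpace ℝ (Fin 3), ∀ t < 0, ∀ x, v t x = b := by
  refine const_of_strainStarved hc hK hd hm fun t ht ε hε => ?_
  have ht0 : 0 < -t := neg_pos.2 ht
  -- the majorant, continuous on `ℝ`, equal to `a/(−τ)` for `τ ≤ t`
  set Λ : ℝ → ℝ := fun τ => a / max (-τ) (-t) with hΛ
  have hden : ∀ τ : ℝ, max (-τ) (-t) ≠ 0 := fun τ => (lt_of_lt_of_le ht0 (le_max_right _ _)).ne'
  have hΛc : Continuous Λ := continuous_const.div (continuous_neg.max continuous_const) hden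
  have hΛeq : ∀ τ, τ ≤ t → Λ τ = a / (-τ) := fun τ hτ => by
    simp only [hΛ, max_eq_left (neg_le_neg hτ)]
  -- the ledger tends to zero along `s = −σ → −∞`
  have hlim : Tendsto (fun σ : ℝ => M * (-t) ^ (-a) * σ ^ (a - β)) atTop (𝓝 0) := by
    have h := (tendsto_rpow_neg_atTop (y := β - a) (by linarith)).const_mul (M * (-t) ^ (-a))
    rw [mul_zero] at h
    exact h.congr' (Eventually.of_forall fun σ => by rw [neg_sub])
  obtain ⟨σ₀, hσ₀⟩ := (hlim.eventually (gt_mem_nhds hε)).exists_forall_of_atTop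
  set σ : ℝ := max σ₀ (-t + 1) with hσ
  have hσt : -t < σ := by rw [hσ]; linarith [le_max_right σ₀ (-t + 1)]
  have hσ0 : 0 < σ := ht0.trans hσt
  have hst : -σ < t := by linarith
  have hs0 : -σ < 0 := by linarith
  refine ⟨-σ, hst, Λ, hΛc, fun τ hτ x ξ => ?_, M * σ ^ (-β), fun x => ?_, ?_⟩
  · rw [hΛeq τ hτ.2]
    exact hstr τ (lt_of_le_of_lt hτ.2 ht) x ξ
  · have h := hω (-σ) hs0 x
    rwa [neg_neg] at h
  · -- `∫_{−σ}^t Λ = a (log σ − log (−t))`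
    have hderiv : ∀ τ ∈ uIcc (-σ) t, HasDerivAt (fun r => -a * Real.log (-r)) (Λ τ) τ := by
      intro τ hτ
      rw [uIcc_of_le hst.le] at hτ
      have hτ0 : -τ ≠ 0 := (neg_pos.2 (lt_of_le_of_lt hτ.2 ht)).ne'
      have h1 : HasDerivAt (fun r : ℝ => Real.log (-r)) ((-τ)⁻¹ * (-1)) τ :=
        (Real.hasDerivAt_log hτ0).comp τ (hasDerivAt_neg τ)
      have h2 := h1.const_mul (-a)
      rw [hΛeq τ hτ.2]
      refine h2.congr_deriv ?_
      rw [div_eq_mul_inv]; ring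
    have hint : ∫ τ in (-σ)..t, Λ τ = a * (Real.log σ - Real.log (-t)) := by
      rw [intervalIntegral.integral_eq_sub_of_hasDerivAt hderiv (hΛc.intervalIntegrable _ _)]
      simp only [neg_neg]
      ring
    rw [hint]
    have hexp : Real.exp (a * (Real.log σ - Real.log (-t))) = σ ^ a * (-t) ^ (-a) := by
      rw [Real.rpow_def_of_pos hσ0, Real.rpow_def_of_pos ht0, ← Real.exp_add]
      congr 1; ring
    rw [hexp]
    have hcalc : M * σ ^ (-β) * (σ ^ a * (-t) ^ (-a)) = M * (-t) ^ (-a) * σ ^ (a - β) := by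
      rw [sub_eq_add_neg, Real.rpow_add hσ0, ← mul_assoc]
      ring
    rw [hcalc]
    exact hσ₀ σ (le_max_left _ _)

/-- Corollary (**HARMONIC GRADIENT FLOOR on print's class**): a class-P flow with `‖∇v(τ,x)‖ ≤ a/(−τ)` for all `τ < 0`,
`x`, where `a < 1`, is one constant vector (stretching exponent `a`, vorticity-decay exponent `1`).  With
`TypeILiouvilleQuiescentGradient` (quiescent ⟺ `sup_x‖∇v(t,·)‖ → 0`): a non-constant QUIESCENT member of print's class
has `limsup_{τ→−∞} (−τ)·sup_x‖∇v(τ,x)‖ ≥ 1` — the print-class face of the Type-I door's unit stretching threshold.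
[cite: MajdaBertozzi2002, eq. (3.80); KochNadirashviliSereginSverak2009, §4] -/
theorem const_of_norm_fderiv_le_div
    {v : ℝ → EuclideanSpace ℝ (Fin 3) → EuclideanSpace ℝ (Fin 3)}
    (hc : ContinuousOn (uncurry v) (Iio 0 ×ˢ univ))
    (hK : ∃ K : ℝ, ∀ t < 0, ∀ x, ‖v t x‖ ≤ K)
    (hd : ∀ t < 0, IsWeaklyDivFree (v t))
    (hm : ∀ s t : ℝ, s < t → t < 0 → ∀ x,
      v t x = heatExtension (v s) (t - s) x - oseenDuhamel 1 s v v t x)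
    {a : ℝ} (ha1 : a < 1)
    (hg : ∀ τ < 0, ∀ x : EuclideanSpace ℝ (Fin 3), ‖fderiv ℝ (v τ) x‖ ≤ a / (-τ)) :
    ∃ b : EuclideanSpace ℝ (Fin 3), ∀ t < 0, ∀ x, v t x = b := by
  refine const_of_stretching_lt_vorticity_decay hc hK hd hm (a := a) (β := 1) (M := ‖curlCLM‖ * a) ha1
    (fun τ hτ x ξ => ?_) (fun τ hτ x => ?_)
  · calc ⟪fderiv ℝ (v τ) x ξ, ξ⟫ ≤ ‖fderiv ℝ (v τ) x ξ‖ * ‖ξ‖ := real_inner_le_norm _ _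
      _ ≤ (‖fderiv ℝ (v τ) x‖ * ‖ξ‖) * ‖ξ‖ :=
          mul_le_mul_of_nonneg_right (ContinuousLinearMap.le_opNorm _ _) (norm_nonneg _)
      _ ≤ (a / (-τ) * ‖ξ‖) * ‖ξ‖ :=
          mul_le_mul_of_nonneg_right (mul_le_mul_of_nonneg_right (hg τ hτ x) (norm_nonneg _)) (norm_nonneg _)
      _ = a / (-τ) * ‖ξ‖ ^ 2 := by ring
  · have hτ0 : 0 < -τ := neg_pos.2 hτ
    calc ‖curl (v τ) x‖ = ‖curlCLM (fderiv ℝ (v τ) x)‖ := rfl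
      _ ≤ ‖curlCLM‖ * ‖fderiv ℝ (v τ) x‖ := ContinuousLinearMap.le_opNorm _ _
      _ ≤ ‖curlCLM‖ * (a / (-τ)) := mul_le_mul_of_nonneg_left (hg τ hτ x) (norm_nonneg curlCLM)
      _ = ‖curlCLM‖ * a * (-τ) ^ (-(1 : ℝ)) := by
          rw [Real.rpow_neg hτ0.le, Real.rpow_one, div_eq_mul_inv, mul_assoc]

end Summit.NavierStokesRegularity.NavierStokesRegularity.Theorems.TypeILiouvilleStrainLedger

end
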